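import Mathlib.Analysis.SpecialFunctions.Log.Basic

/-!
# T⁴ programme, spine estimate NE1′ (node O3b/H2) — «σ-ROUTE»: the arithmetic of the ONE displayed clause that consumes
# the met-step exponent σ on [Balaban1989LargeFieldII]'s primary (un-normalised) route, with a GENERAL summand in place of «+1»

Cell `pub-balaban`, sub-cell `t4`, BINDER-OWNERS row NE1′; owner lineage t4-ne1p-p1 (PROVER seat P1, «RG-trajectory comparison»),
generation 24; companion of the owner memo `HOME/b2b-balaban-t4-ne1p-p1/g24/OWNER-ANSWERS-g24.md` §2 (reading «σ-ROUTE»).  ADDITIVE —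
imports Mathlib only, modifies nothing; THEOREMS ONLY (no `def`, no `def … : Prop`).

WHY THIS FILE.  The wall item (w2-act) of the record `t4/T4-EST-NE1p-P1.md` §4 («THE NUMBER»: a per-met-component action-oscillation
margin `s̄⁰ < 1`, asserted nowhere) is charged by the lineage's step law `hFn = wOp (expWeight base (𝒜+𝒬)) …` — the NORMALISED met
operation, i.e. the TYPE of [Balaban1989LargeFieldII] (1.75) p. 380 / (1.103)–(1.104) p. 391 («another possible representation»).
On the route by which that paper's Theorem 1 is actually closed (p. 390 «From (1.72), (1.98), and the above definitions …»,
p. 391 l. 2 «This completes the proof of Theorem 1») the met operations enter the polymer activities (1.91) UN-NORMALISED and σ is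
consumed ONLY as the additive summand «+1» of the exponent in (1.92) p. 388, absorbed on p. 389 by the displayed clause
«−2(1+β₀)⁻¹p₀(g_k) + 1 + 2κ(100R_k)^d ≤ −(3/2)p₀(g_k) (for example, take β₀ = 1/7, then this means that −(1/4)p₀(g_k) + 1 +
2κ(100R_k)^d ≤ 0 …)» — LOCI only (the manuscript under audit is not cited for any disputed step; TYPE/CONTEXT).  This file
records, in kernel, the arithmetic of that clause SHAPE with a general summand `S` in place of «+1»:

* §1 `payClause_iff` / `payClause_iff_quarter`: the clause `−2(1+β₀)⁻¹p₀ + S + V ≤ −(3/2)p₀` is EQUIVALENT to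
  `S + V ≤ (2(1+β₀)⁻¹ − 3/2)·p₀` (at `β₀ = 1/7`: `S + V ≤ p₀/4`) — the printed parenthetical is the case `S = 1`
  (`payClause_print_case`); it is monotone in the summand (`payClause_mono`).
* §2 EXTENSIVE SUMMANDS WITH UNIFORM DENSITY: if `S ≤ s·W` and `V = 2κ·W` for a volume `W ≥ 0` (print: `W = (100R_k)^d`), the
  clause follows from the p₀-floor `4(s + 2κ)·W ≤ p₀` (`payClause_of_density`) — a floor of print's own kind, and DOMINATED by a
  floor of the standing type of (1.88) p. 387, `c·R^(d+2) ≤ p₀` with `c ≥ 4(s+2κ)·100^d` and `R ≥ 1` (`payClause_of_standing`):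
  an extensive σ with a K-, k- and history-free density changes the constant of the clause, not its kind.  THREE densities
  (quadratic-form half, V-half, observable budget) add (`payClause_of_three_densities`).
* §3 THE MET FACTOR AND THE ABSORPTION CONSTANT: under the clause the per-component activity factor obeys
  `exp(−2(1+β₀)⁻¹p₀ + S + V) ≤ exp(−(3/2)p₀)` (`metFactor_le`), and an absorption amplitude of the form `vol·exp(D − q·p₀)`
  is `≤ 1` as soon as `log vol + D ≤ q·p₀` (`absorbConst_le_one`); with `A·η ≤ 1` and no own dressing the count-form class
  condition of the lineage's absorption door (`T4TrajectoryComparison.birthsFromOld_prodRate_of_absorbsFrom_card`'s binder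
  `hβ : β j + A·η·(A₀τ^{K−j}) ≤ A₀τ^{K−j}`) holds (`hbeta_of_absorbConst`) — the (w5b) door's constant in the shape the reading needs.

HONEST FRAMING.  Arithmetic over SHAPES; nothing of Bałaban's densities is asserted or instantiated; the densities `s`, the
volume `W`, the floor constants are BINDERS, no numeral is taken from print as a fact (β₀ = 1/7 is the printed EXAMPLE value,
entering only the specialised corollaries).  Whether the dressed run may take the un-normalised route is the owner's READING
(memo §2–§3), graded by the referees, not a theorem here.  NE1′ ⇐ the named binders, NOT proved; the wall of record (w1),
(w2-act) [re-located by the memo, not closed], (w3)⁺, (w4)–(w7) stands; 0 leaves instantiated on Bałaban's densities; spine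
PROVED 0∕9.  Rung (B)+1 on ONE finite four-torus — NOT infinite volume, NOT a mass gap, NOT OS on ℝ⁴, NOT Clay.  HONEST
DEPENDENCY: continuum YM on T⁴ ⇐ BetaPertH ∧ nine spine estimates (0/9 proved); BetaPertH ⇐ (D1) ∧ (D4) ∧ CAP+tail; G-an2-4
gates asym, D1 and NE2/3/4.
-/

noncomputable section

namespace Summit.QuantumFields.BalabanUV.T4Continuum.NE1p.DressedSigmaRoute

/-! ## §1 The clause with a general summand -/

/-- **THE CLAUSE, SOLVED FOR THE SUMMAND** [arith]: for `1 + β₀ ≠ 0`,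
`−2(1+β₀)⁻¹·p₀ + S + V ≤ −(3/2)·p₀ ↔ S + V ≤ (2(1+β₀)⁻¹ − 3/2)·p₀`.  Print's (1.92)/(p. 389) clause is the case `S = 1`,
`V = 2κ(100R_k)^d` (TYPE only). -/
theorem payClause_iff (β₀ p₀ S V : ℝ) :
    -2 * (1 + β₀)⁻¹ * p₀ + S + V ≤ -(3 / 2) * p₀ ↔ S + V ≤ (2 * (1 + β₀)⁻¹ - 3 / 2) * p₀ := by
  constructor <;> intro h <;> linarith

/-- **AT THE PRINTED EXAMPLE VALUE `β₀ = 1/7`** [arith]: the clause reads `S + V ≤ p₀/4` («this means that −(1/4)p₀(g_k) + 1 +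
2κ(100R_k)^d ≤ 0» is the case `S = 1`). -/
theorem payClause_iff_quarter (p₀ S V : ℝ) :
    -2 * (1 + (1 / 7 : ℝ))⁻¹ * p₀ + S + V ≤ -(3 / 2) * p₀ ↔ S + V ≤ p₀ / 4 := by
  rw [payClause_iff]
  norm_num
  constructor <;> intro h <;> linarith

/-- **THE PRINTED CASE** [arith]: with the summand `1` the quarter form is `1 + V ≤ p₀/4`, i.e. `−p₀/4 + 1 + V ≤ 0`. -/
theorem payClause_print_case (p₀ V : ℝ) :
    -2 * (1 + (1 / 7 : ℝ))⁻¹ * p₀ + 1 + V ≤ -(3 / 2) * p₀ ↔ -(p₀ / 4) + 1 + V ≤ 0 := by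
  rw [payClause_iff_quarter]
  constructor <;> intro h <;> linarith

/-- **MONOTONE IN THE SUMMAND** [arith]: a smaller summand (and volume charge) inherits the clause. -/
theorem payClause_mono {β₀ p₀ S S' V V' : ℝ} (hS : S ≤ S') (hV : V ≤ V')
    (h : -2 * (1 + β₀)⁻¹ * p₀ + S' + V' ≤ -(3 / 2) * p₀) :
    -2 * (1 + β₀)⁻¹ * p₀ + S + V ≤ -(3 / 2) * p₀ := by
  linarith

/-! ## §2 Extensive summands with uniform density -/

/-- **EXTENSIVE σ WITH A UNIFORM DENSITY IS A CONSTANT CHANGE** [arith]: if the summand is extensive in the met component's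
volume with density `s` (`S ≤ s·W`) and the volume charge is print's `V = 2κ·W` (TYPE: `W = (100R_k)^d`), then the
p₀-floor `4·(s + 2κ)·W ≤ p₀` gives the clause at `β₀ = 1/7`. -/
theorem payClause_of_density {p₀ S s κ W : ℝ} (hS : S ≤ s * W)
    (hfloor : 4 * (s + 2 * κ) * W ≤ p₀) :
    -2 * (1 + (1 / 7 : ℝ))⁻¹ * p₀ + S + 2 * κ * W ≤ -(3 / 2) * p₀ := by
  rw [payClause_iff_quarter]
  have h1 : S + 2 * κ * W ≤ (s + 2 * κ) * W := by nlinarith [hS]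
  linarith

/-- **THREE DENSITIES ADD** [arith]: quadratic-form half `S_Q ≤ s_Q·W`, V-half `S_V ≤ s_V·W`, observable budget
`S_obs ≤ b·W`; the floor `4·(s_Q + s_V + b + 2κ)·W ≤ p₀` gives the clause for the total summand. -/
theorem payClause_of_three_densities {p₀ SQ SV Sobs sQ sV b κ W : ℝ} (hQ : SQ ≤ sQ * W)
    (hV : SV ≤ sV * W) (hobs : Sobs ≤ b * W) (hfloor : 4 * (sQ + sV + b + 2 * κ) * W ≤ p₀) :
    -2 * (1 + (1 / 7 : ℝ))⁻¹ * p₀ + (SQ + SV + Sobs) + 2 * κ * W ≤ -(3 / 2) * p₀ :=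
  payClause_of_density (s := sQ + sV + b) (by nlinarith [hQ, hV, hobs]) hfloor

/-- **THE STANDING-TYPE FLOOR DOMINATES** [arith]: a floor of the kind of (1.88) p. 387 («… + O(1)3(100M)^dR^{d+2} … for p₀
large and γ small enough», TYPE only), `c·R^(d+2) ≤ p₀` with `4·(s + 2κ)·100^d ≤ c` and `R ≥ 1`, `0 ≤ s + 2κ`, implies the
volume floor `4·(s + 2κ)·(100·R)^d ≤ p₀` of `payClause_of_density` — an extensive σ of uniform density costs a CONSTANT inside a
restriction print already carries in a stronger power of `R`. -/
theorem floor_of_standing {p₀ s κ c R : ℝ} {d : ℕ} (hR : 1 ≤ R) (hsk : 0 ≤ s + 2 * κ)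
    (hc : 4 * (s + 2 * κ) * 100 ^ d ≤ c) (hfloor : c * R ^ (d + 2) ≤ p₀) :
    4 * (s + 2 * κ) * (100 * R) ^ d ≤ p₀ := by
  have hR0 : 0 ≤ R := le_trans zero_le_one hR
  have hRd : (0 : ℝ) ≤ R ^ d := pow_nonneg hR0 d
  have hpow : R ^ d ≤ R ^ (d + 2) := pow_le_pow_right₀ hR (by omega)
  have h1 : 4 * (s + 2 * κ) * (100 * R) ^ d = (4 * (s + 2 * κ) * 100 ^ d) * R ^ d := by
    rw [mul_pow]; ring
  rw [h1]
  have h2 : (4 * (s + 2 * κ) * 100 ^ d) * R ^ d ≤ c * R ^ d :=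
    mul_le_mul_of_nonneg_right hc hRd
  have hc0 : 0 ≤ c := le_trans (by positivity) hc
  have h3 : c * R ^ d ≤ c * R ^ (d + 2) := mul_le_mul_of_nonneg_left hpow hc0
  linarith

/-- **THE CLAUSE FROM THE STANDING-TYPE FLOOR** [arith]: composition of `floor_of_standing` and `payClause_of_density` at
`W = (100·R)^d`. -/
theorem payClause_of_standing {p₀ S s κ c R : ℝ} {d : ℕ} (hR : 1 ≤ R) (hsk : 0 ≤ s + 2 * κ)
    (hS : S ≤ s * (100 * R) ^ d) (hc : 4 * (s + 2 * κ) * 100 ^ d ≤ c) (hfloor : c * R ^ (d + 2) ≤ p₀) :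
    -2 * (1 + (1 / 7 : ℝ))⁻¹ * p₀ + S + 2 * κ * (100 * R) ^ d ≤ -(3 / 2) * p₀ :=
  payClause_of_density hS (floor_of_standing hR hsk hc hfloor)

/-! ## §3 The met factor and the absorption constant -/

/-- **THE PER-COMPONENT ACTIVITY FACTOR UNDER THE CLAUSE** [arith]: `exp(−2(1+β₀)⁻¹p₀ + S + V) ≤ exp(−(3/2)·p₀)` — the shape in
which (1.92)'s product over met components is combined on p. 389 (TYPE), now with a general summand. -/
theorem metFactor_le {β₀ p₀ S V : ℝ} (h : -2 * (1 + β₀)⁻¹ * p₀ + S + V ≤ -(3 / 2) * p₀) :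
    Real.exp (-2 * (1 + β₀)⁻¹ * p₀ + S + V) ≤ Real.exp (-(3 / 2) * p₀) :=
  Real.exp_le_exp.mpr h

/-- Under the clause and `0 ≤ p₀` the per-component factor is at most `1`. [arith] -/
theorem metFactor_le_one {β₀ p₀ S V : ℝ} (hp : 0 ≤ p₀) (h : -2 * (1 + β₀)⁻¹ * p₀ + S + V ≤ -(3 / 2) * p₀) :
    Real.exp (-2 * (1 + β₀)⁻¹ * p₀ + S + V) ≤ 1 := by
  refine (metFactor_le h).trans ?_
  rw [Real.exp_le_one_iff]
  linarith

/-- **AN ABSORPTION AMPLITUDE PAID BY THE COMPONENT'S SMALL FACTOR** [arith]: an amplitude of the form `vol·exp(D − q·p₀)`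
(`vol > 0` a volume/multiplicity factor, `D` the total exponent demand — σ-summand, observable budget, … —, `q·p₀` the share of
the met component's suppression lent to the dressed bookkeeping) is `≤ 1` as soon as `log vol + D ≤ q·p₀`. -/
theorem absorbConst_le_one {vol D q p₀ : ℝ} (hvol : 0 < vol) (h : Real.log vol + D ≤ q * p₀) :
    vol * Real.exp (D - q * p₀) ≤ 1 := by
  have hv : vol = Real.exp (Real.log vol) := (Real.exp_log hvol).symm
  rw [hv, ← Real.exp_add, Real.exp_le_one_iff]
  have : Real.log (Real.exp (Real.log vol)) = Real.log vol := by rw [Real.exp_log hvol]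
  linarith

/-- The same with the demand split as `D = S + b` (σ-summand plus observable budget). [arith] -/
theorem absorbConst_le_one_split {vol S b q p₀ : ℝ} (hvol : 0 < vol) (h : Real.log vol + S + b ≤ q * p₀) :
    vol * Real.exp (S + b - q * p₀) ≤ 1 :=
  absorbConst_le_one hvol (by linarith)

/-- **THE DOOR'S CLASS CONDITION FROM A PAID CONSTANT** [arith]: with NO own dressing at the absorption event (`β ≡ 0`), a
nonnegative class diagonal `D j` (TYPE: `A₀·τ^{K−j}`) and an absorption constant with `A·η ≤ 1` (`η` = the count of absorbed
families), the count-form class condition `β j + A·η·D j ≤ D j` of the lineage's absorption door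
(`T4TrajectoryComparison.birthsFromOld_prodRate_of_absorbsFrom_card`, binder `hβ`) holds at every scale. -/
theorem hbeta_of_absorbConst {A η : ℝ} {β D : ℕ → ℝ} (hβ : ∀ j, β j = 0) (hD : ∀ j, 0 ≤ D j)
    (hAη : A * η ≤ 1) (j : ℕ) : β j + A * η * D j ≤ D j := by
  rw [hβ j, zero_add]
  calc A * η * D j ≤ 1 * D j := mul_le_mul_of_nonneg_right hAη (hD j)
    _ = D j := one_mul _

/-- **`A·η ≤ 1` FROM THE CLAUSE'S SHAPE** [arith]: if the absorption constant is `A = vol·exp(D − q·p₀)` and the count of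
absorbed families is `η ≤ vol'` (both volumes of the met component, `vol, vol' > 0`), then `log vol + log vol' + D ≤ q·p₀` gives
`A·η ≤ 1`. -/
theorem absorbCount_le_one {vol vol' D q p₀ η : ℝ} (hvol : 0 < vol) (hvol' : 0 < vol') (hη : η ≤ vol')
    (h : Real.log vol + Real.log vol' + D ≤ q * p₀) :
    vol * Real.exp (D - q * p₀) * η ≤ 1 := by
  have hA : 0 ≤ vol * Real.exp (D - q * p₀) := mul_nonneg hvol.le (Real.exp_pos _).le
  calc vol * Real.exp (D - q * p₀) * η ≤ vol * Real.exp (D - q * p₀) * vol' :=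
        mul_le_mul_of_nonneg_left hη hA
    _ = (vol * vol') * Real.exp (D - q * p₀) := by ring
    _ ≤ 1 := by
        refine absorbConst_le_one (mul_pos hvol hvol') ?_
        rw [Real.log_mul hvol.ne' hvol'.ne']
        exact h

end Summit.QuantumFields.BalabanUV.T4Continuum.NE1p.DressedSigmaRoute

end
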